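import Mathlib
import HarnessLib
import Summits.AtomisticToContinuum.FouriersLaw.Theses.CoercivePulse
import Summits.AtomisticToContinuum.FouriersLaw.Theorems.JunctionLocalityConductanceLowerBoundStubBulkAbelFloorOfHeatVarianceBets

/-!
# Crux `ConductanceLowerBound` (CLB, item stmt-AtomisticToContinuum-11749; child of the gen-1 split of `AbelThermodynamicLimit`,
# stmt-AtomisticToContinuum-12596) on route CoercivePulse: CLB from the route's OTHER items and the sibling (R)

Support file (closes nothing).  Crux-strategist s2 of stmt-11749 showed (landed as
`Theorems/JunctionLocalityConductanceLowerBoundStubBulkAbelFloorOfHeatVarianceBets.lean`, p156938) that on route CageBudgetFekete the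
child CLB follows from the route's heat-variance items and the sibling child (R) `UniformAbelianRegularity` (stmt-13416), and advised
"the same check for CoercivePulse, whose witness is also `SymmetricSetup`'s".  This file IS that check, affirmative:

* `bulkAbelFloor_of_linearSpread` — `CoercivePulse.SymmetricSetup → PulseCalculus → LinearSpread → ` bulk Abel floor witness
  (a shift-invariant Gibbs state `μ_T`, a `μ_T`-preserving dynamics with absolutely convergent correlations, and `a, ν₀ > 0` with
  `a ≤ ∫₀^∞ e^{−νt} C_T(t) dt` for `ν ∈ (0, ν₀)`).  Proof: the diffusive lower envelope `M(t) ≥ m t` (`t ≥ t₂`) of the Helfand moment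
  and continuity of `M` give an AFFINE floor `M(t) − M(0) ≥ m t − K` for all `t > 0`; the Helfand–Laplace identity of `PulseCalculus`,
  `∫₀^∞e^{−νt}C_T = (ν²/2)∫₀^∞e^{−νt}(M(t)−M(0))dt`, with `∫₀^∞e^{−νt}dt = 1/ν`, `∫₀^∞te^{−νt}dt = 1/ν²` gives
  `∫₀^∞e^{−νt}C_T ≥ m/2 − Kν/2 ≥ m/4` for `ν < m/(2K)` (the Abelian lemma the route's `closes` proves inline, isolated).
* `conductanceLowerBound_of_linearSpread` — COROLLARY: `SymmetricSetup → PulseCalculus → LinearSpread → UniformAbelianRegularity →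
  CoercivePulse.ConductanceLowerBound`, by the landed bridges `abelFloor_openChain_of_bulkWitness` (bulk floor ⇒ open-chain Abel floor
  (A⁻), via the fixed-frequency matching S3), `slowRegularity_signed_of_uniformAbelianRegularity` ((R) ⇒ (R⁻)) and
  `conductanceLowerBound_of_abelFloor_and_signedSlowRegularity` ((A⁻) → (R⁻) → CLB, Kubo identity (K) + Abelian split).
  So on route CoercivePulse, as on CageBudgetFekete, the child stmt-11749 carries no content beyond the route's own cruxes
  `LinearSpread`, `PulseCalculus`, `SymmetricSetup` and the sibling stmt-13416.

References: Helfand 1960 (Einstein–Helfand moment); Kundu–Dhar–Narayan 2009 (open-system Green–Kubo); Bonetto–Lebowitz–Rey-Bellet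
2000 §7.  No definitions, no named facts, no sorry.
-/

noncomputable section

open MeasureTheory Filter Set Topology
open Literature.MathematicalPhysics.KineticTheory.HeatConduction

namespace Summit.AtomisticToContinuum.FouriersLaw.Cruxes.ConductanceLowerBound.AbelFloorExchange

/-- **BULK ABEL FLOOR FROM THE DIFFUSIVE LOWER ENVELOPE (route CoercivePulse).**  From `SymmetricSetup` (the symmetric DLR state and
its shift-covariant dynamics), `PulseCalculus` (absolutely convergent correlations, continuity of the Helfand moment `M`, and the
Helfand–Laplace identity `∫₀^∞e^{−νt}C_T = (ν²/2)∫₀^∞e^{−νt}(M(t)−M(0))dt`) and `LinearSpread` (`M(t) ≥ m·t` for `t ≥ t₂`):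
there are `a, ν₀ > 0` with `a ≤ ∫₀^∞ e^{−νt} C_T(t) dt` for all `ν ∈ (0, ν₀)`.  Affine floor `M(t) − M(0) ≥ m t − K` (`t > 0`,
`K = B + |M(0)| + m·max(t₂,1)`, `B` a bound of `|M − M(0)|` on `[0, max(t₂,1)]`), then `∫e^{−νt}C_T ≥ m/2 − Kν/2 ≥ m/4` for
`ν < m/(2K)`. [cite: Helfand1960, eq. (3.10)] -/
theorem bulkAbelFloor_of_linearSpread :
    Summit.AtomisticToContinuum.FouriersLaw.Theses.CoercivePulse.SymmetricSetup →
    Summit.AtomisticToContinuum.FouriersLaw.Theses.CoercivePulse.PulseCalculus →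
    Summit.AtomisticToContinuum.FouriersLaw.Theses.CoercivePulse.LinearSpread →
    ∀ ω₂ lam β γ : ℝ, 0 < ω₂ → 0 < lam → 0 < β → 0 < γ → ∀ T : ℝ, 0 < T →
      ∃ (μT : Measure ChainConfig) (D : InfiniteChainDynamics (pinnedChain ω₂ lam β γ)) (a ν₀ : ℝ),
        (pinnedChain ω₂ lam β γ).IsChainGibbsMeasure T μT ∧ IsShiftInvariant μT ∧
        D.PreservesMeasure μT ∧ (∀ t : ℝ, D.HasAbsConvergentCorrelation μT t) ∧ 0 < a ∧ 0 < ν₀ ∧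
        ∀ ν : ℝ, 0 < ν → ν < ν₀ →
          a ≤ ∫ t in Set.Ioi (0:ℝ), Real.exp (-(ν * t)) * D.currentCorrelation μT t := by
  intro hSet hPC hLS ω₂ lam β γ hω hl hβ _hγ T hT
  obtain ⟨μT, hG, hSI, hRefl, D, hP, hShift⟩ := hSet ω₂ lam β γ hω hl hβ T hT
  -- the split-bond site energy `h` and the pulse `S`
  set h : ChainConfig → ℤ → ℝ := fun σ x => (σ x).2 ^ 2 / 2 + (pinnedChain ω₂ lam β γ).U (σ x).1 +
      ((pinnedChain ω₂ lam β γ).V ((σ (x + 1)).1 - (σ x).1) +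
        (pinnedChain ω₂ lam β γ).V ((σ x).1 - (σ (x - 1)).1)) / 2 with hh
  set S : ℤ → ℝ → ℝ := fun x t =>
      ∫ σ, (h σ 0 - ∫ σ', h σ' 0 ∂μT) * (h (D.flow t σ) x - ∫ σ', h σ' 0 ∂μT) ∂μT with hS
  obtain ⟨hAC, _hCint, hsum, hMcont, hLap⟩ :=
    hPC ω₂ lam β γ hω hl hβ T hT μT hG hSI hRefl D hP hShift h hh S hS
  obtain ⟨m, t₂, hm, hspread⟩ := hLS ω₂ lam β γ hω hl hβ T hT μT hG hSI hRefl D hP hShift h hh S hS hsum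
  -- the centred Helfand moment `V t = M t - M 0` and the Abel means `A ν`
  set V : ℝ → ℝ := fun t => (∑' x : ℤ, (x : ℝ) ^ 2 * S x t) - (∑' x : ℤ, (x : ℝ) ^ 2 * S x 0) with hV
  set A : ℝ → ℝ := fun ν => ∫ t in Ioi (0:ℝ), Real.exp (-(ν * t)) * D.currentCorrelation μT t with hAd
  have hA : ∀ ν : ℝ, 0 < ν → A ν = ν ^ 2 / 2 * ∫ t in Ioi (0:ℝ), Real.exp (-(ν * t)) * V t :=
    fun ν hν => (hLap ν hν).2
  have hint : ∀ ν : ℝ, 0 < ν → IntegrableOn (fun t => Real.exp (-(ν * t)) * V t) (Ioi 0) :=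
    fun ν hν => (hLap ν hν).1
  have hVcont : Continuous V := hMcont.sub continuous_const
  have hV0 : V 0 = 0 := sub_self _
  -- a bound `B` of `|V|` on `[0, t₂']`, `t₂' = max t₂ 1`
  set t₂' : ℝ := max t₂ 1 with ht₂'
  have ht₂'pos : 0 < t₂' := lt_of_lt_of_le one_pos (le_max_right _ _)
  obtain ⟨B, hB⟩ := (isCompact_Icc (a := (0:ℝ)) (b := t₂')).exists_bound_of_continuousOn hVcont.continuousOn
  have hB0 : 0 ≤ B := le_trans (norm_nonneg _) (hB 0 ⟨le_rfl, ht₂'pos.le⟩)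
  -- the affine floor `m t - K ≤ V t` for `t > 0`
  set M0 : ℝ := ∑' x : ℤ, (x : ℝ) ^ 2 * S x 0 with hM0
  set K : ℝ := B + |M0| + m * t₂' with hK
  have hKpos : 0 < K := by
    have : 0 < m * t₂' := mul_pos hm ht₂'pos
    have := abs_nonneg M0
    linarith
  have hlow : ∀ t : ℝ, 0 < t → m * t + (-K) ≤ V t := by
    intro t ht
    rcases le_or_gt t₂' t with hle | hlt
    · -- beyond `t₂'`: the diffusive lower envelope
      have h1 : m * t ≤ ∑' x : ℤ, (x : ℝ) ^ 2 * S x t := hspread t (le_trans (le_max_left _ _) hle)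
      have h2 : V t = (∑' x : ℤ, (x : ℝ) ^ 2 * S x t) - M0 := rfl
      have h3 : M0 ≤ |M0| := le_abs_self M0
      have h4 : 0 ≤ m * t₂' := (mul_pos hm ht₂'pos).le
      rw [h2]
      linarith
    · -- before `t₂'`: continuity bound
      have h1 : ‖V t‖ ≤ B := hB t ⟨ht.le, hlt.le⟩
      have h2 : -B ≤ V t := by
        have := Real.norm_eq_abs (V t) ▸ h1
        exact (abs_le.mp this).1
      have h3 : m * t ≤ m * t₂' := mul_le_mul_of_nonneg_left hlt.le hm.le
      have h4 : 0 ≤ |M0| := abs_nonneg M0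
      linarith
  -- explicit Laplace integrals
  have hE0 : ∀ ν : ℝ, 0 < ν → IntegrableOn (fun t => Real.exp (-(ν * t))) (Ioi 0) ∧
      ∫ t in Ioi (0:ℝ), Real.exp (-(ν * t)) = ν⁻¹ := fun ν hν => by
    refine ⟨by simpa only [neg_mul] using exp_neg_integrableOn_Ioi 0 hν, ?_⟩
    rw [show (fun t : ℝ => Real.exp (-(ν * t))) = fun t => Real.exp (-ν * t) from funext fun t => by rw [neg_mul],
      integral_exp_mul_Ioi (neg_lt_zero.mpr hν) 0, mul_zero, Real.exp_zero, neg_div, one_div, inv_neg, neg_neg]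
  have hE1 : ∀ ν : ℝ, 0 < ν → IntegrableOn (fun t => Real.exp (-(ν * t)) * t) (Ioi 0) ∧
      ∫ t in Ioi (0:ℝ), Real.exp (-(ν * t)) * t = (ν ^ 2)⁻¹ := fun ν hν => by
    have h := Real.integral_rpow_mul_exp_neg_mul_Ioi (a := 2) (r := ν) (by norm_num) hν
    rw [Real.Gamma_two, mul_one, Real.rpow_two, one_div, inv_pow] at h
    have hv : ∫ t in Ioi (0:ℝ), Real.exp (-(ν * t)) * t = (ν ^ 2)⁻¹ :=
      (setIntegral_congr_fun measurableSet_Ioi fun t _ => by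
        rw [show (2:ℝ) - 1 = 1 by norm_num, Real.rpow_one, mul_comm]).trans h
    exact ⟨Integrable.of_integral_ne_zero (by rw [hv]; positivity), hv⟩
  have key : ∀ ν : ℝ, 0 < ν → ∀ p q : ℝ, IntegrableOn (fun t => Real.exp (-(ν * t)) * (p * t + q)) (Ioi 0) ∧
      ∫ t in Ioi (0:ℝ), Real.exp (-(ν * t)) * (p * t + q) = p * (ν ^ 2)⁻¹ + q * ν⁻¹ := fun ν hν p q => by
    obtain ⟨hi0, hv0⟩ := hE0 ν hν
    obtain ⟨hi1, hv1⟩ := hE1 ν hν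
    rw [show (fun t : ℝ => Real.exp (-(ν * t)) * (p * t + q)) =
        fun t => p * (Real.exp (-(ν * t)) * t) + q * Real.exp (-(ν * t)) from funext fun t => by ring]
    exact ⟨(hi1.const_mul p).add (hi0.const_mul q), by
      rw [integral_add (hi1.const_mul p) (hi0.const_mul q), integral_const_mul, integral_const_mul, hv1, hv0]⟩
  -- the Abelian lower bound `A ν ≥ m/2 − K/2 · ν`
  have hAlow : ∀ ν : ℝ, 0 < ν → m / 2 - K / 2 * ν ≤ A ν := by
    intro ν hν
    obtain ⟨iL, vL⟩ := key ν hν m (-K)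
    have cL := setIntegral_mono_on iL (hint ν hν) measurableSet_Ioi
      fun t ht => mul_le_mul_of_nonneg_left (hlow t ht) (Real.exp_pos (-(ν * t))).le
    rw [vL] at cL
    rw [hA ν hν, ← show ν ^ 2 / 2 * (m * (ν ^ 2)⁻¹ + -K * ν⁻¹) = m / 2 - K / 2 * ν by
      field_simp; ring]
    exact mul_le_mul_of_nonneg_left cL (by positivity)
  -- output the witness: `a = m/4`, `ν₀ = m/(2K)`
  refine ⟨μT, D, m / 4, m / (2 * K), hG, hSI, hP, hAC, by positivity, by positivity, fun ν hν hνlt => ?_⟩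
  have h1 := hAlow ν hν
  have h2 : K / 2 * ν ≤ m / 4 := by
    have h3 : ν * (2 * K) < m := by
      have := (lt_div_iff₀ (show 0 < 2 * K by positivity)).mp hνlt
      linarith
    nlinarith
  show m / 4 ≤ A ν
  linarith

/-- **`CoercivePulse.ConductanceLowerBound` from the route's OTHER cruxes.**  On route CoercivePulse the child stmt-11749 of the gen-1
split of `AbelThermodynamicLimit` (stmt-12596) is implied by `SymmetricSetup`, `PulseCalculus`, `LinearSpread` (the route's frame, its
pulse calculus and its rank-2 bet) together with the sibling child `UniformAbelianRegularity` (stmt-13416; only its lower half is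
used): bulk Abel floor ⇒ open-chain Abel floor (A⁻) at fixed frequency (landed matching), (R) ⇒ (R⁻), and (A⁻) ∧ (R⁻) ⇒ CLB by the
Kubo identity (K) and the Abelian split. [cite: KunduDharNarayan2009, p. 3] -/
theorem conductanceLowerBound_of_linearSpread
    (hSet : Summit.AtomisticToContinuum.FouriersLaw.Theses.CoercivePulse.SymmetricSetup)
    (hPC : Summit.AtomisticToContinuum.FouriersLaw.Theses.CoercivePulse.PulseCalculus)
    (hLS : Summit.AtomisticToContinuum.FouriersLaw.Theses.CoercivePulse.LinearSpread)
    (hR : Summit.AtomisticToContinuum.FouriersLaw.Theses.CoercivePulse.UniformAbelianRegularity) :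
    Summit.AtomisticToContinuum.FouriersLaw.Theses.CoercivePulse.ConductanceLowerBound :=
  conductanceLowerBound_of_abelFloor_and_signedSlowRegularity
    (abelFloor_openChain_of_bulkWitness (bulkAbelFloor_of_linearSpread hSet hPC hLS))
    (slowRegularity_signed_of_uniformAbelianRegularity hR)

end Summit.AtomisticToContinuum.FouriersLaw.Cruxes.ConductanceLowerBound.AbelFloorExchange

end
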